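import Mathlib
import Summits.Ventures.DiscreteObjects.Mahler.CensusKernelDeg20P101
import Summits.Ventures.DiscreteObjects.Mahler.CensusKernelDeg20P102
import Summits.Ventures.DiscreteObjects.Mahler.CensusKernelDeg20P103
import Summits.Ventures.DiscreteObjects.Mahler.CensusKernelDeg20P104
import Summits.Ventures.DiscreteObjects.Mahler.CensusKernelDeg20P105
import Summits.Ventures.DiscreteObjects.Mahler.CensusKernelDeg20P106
import Summits.Ventures.DiscreteObjects.Mahler.CensusKernelDeg20P107
import Summits.Ventures.DiscreteObjects.Mahler.CensusKernelDeg20P108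
import Summits.Ventures.DiscreteObjects.Mahler.CensusKernelDeg20P109
import Summits.Ventures.DiscreteObjects.Mahler.CensusKernelDeg20P110
import Summits.Ventures.DiscreteObjects.Mahler.CensusKernelDeg20P111
import Summits.Ventures.DiscreteObjects.Mahler.CensusKernelDeg20P112
import Summits.Ventures.DiscreteObjects.Mahler.CensusKernelDeg20P113
import Summits.Ventures.DiscreteObjects.Mahler.CensusKernelDeg20P114
import Summits.Ventures.DiscreteObjects.Mahler.CensusKernelDeg20P115
import Summits.Ventures.DiscreteObjects.Mahler.CensusKernelDeg20P116
import Summits.Ventures.DiscreteObjects.Mahler.CensusKernelDeg20P117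
import Summits.Ventures.DiscreteObjects.Mahler.CensusKernelDeg20P118
import Summits.Ventures.DiscreteObjects.Mahler.CensusKernelDeg20P119
import Summits.Ventures.DiscreteObjects.Mahler.CensusKernelDeg20P120
import Summits.Ventures.DiscreteObjects.Mahler.CensusKernelDeg20P121
import Summits.Ventures.DiscreteObjects.Mahler.CensusKernelDeg20P122
import Summits.Ventures.DiscreteObjects.Mahler.CensusKernelDeg20P123
import Summits.Ventures.DiscreteObjects.Mahler.CensusKernelDeg20P124
import Summits.Ventures.DiscreteObjects.Mahler.CensusKernelDeg20P125
import Summits.Ventures.DiscreteObjects.Mahler.CensusKernelDeg20P126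
import Summits.Ventures.DiscreteObjects.Mahler.CensusKernelDeg20P127
import Summits.Ventures.DiscreteObjects.Mahler.CensusKernelDeg20P128
import Summits.Ventures.DiscreteObjects.Mahler.CensusKernelDeg20P129
import Summits.Ventures.DiscreteObjects.Mahler.CensusKernelDeg20P130
import Summits.Ventures.DiscreteObjects.Mahler.CensusKernelDeg20P131
import Summits.Ventures.DiscreteObjects.Mahler.CensusKernelDeg20P132
import Summits.Ventures.DiscreteObjects.Mahler.CensusKernelDeg20P133
import Summits.Ventures.DiscreteObjects.Mahler.CensusKernelDeg20P134
import Summits.Ventures.DiscreteObjects.Mahler.CensusKernelDeg20P135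
import Summits.Ventures.DiscreteObjects.Mahler.CensusKernelDeg20P136
import Summits.Ventures.DiscreteObjects.Mahler.CensusKernelDeg20P137
import Summits.Ventures.DiscreteObjects.Mahler.CensusKernelDeg20P138
import Summits.Ventures.DiscreteObjects.Mahler.CensusKernelDeg20P139
import Summits.Ventures.DiscreteObjects.Mahler.CensusKernelDeg20P140
import Summits.Ventures.DiscreteObjects.Mahler.CensusKernelDeg20P141
import Summits.Ventures.DiscreteObjects.Mahler.CensusKernelDeg20P142
import Summits.Ventures.DiscreteObjects.Mahler.CensusKernelDeg20P143
import Summits.Ventures.DiscreteObjects.Mahler.CensusKernelDeg20P144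
import Summits.Ventures.DiscreteObjects.Mahler.CensusKernelDeg20P145
import Summits.Ventures.DiscreteObjects.Mahler.CensusKernelDeg20P146
import Summits.Ventures.DiscreteObjects.Mahler.CensusKernelDeg20P147
import Summits.Ventures.DiscreteObjects.Mahler.CensusKernelDeg20P148
import Summits.Ventures.DiscreteObjects.Mahler.CensusKernelDeg20P149
import Summits.Ventures.DiscreteObjects.Mahler.CensusKernelDeg20P150
import Summits.Ventures.DiscreteObjects.Mahler.CensusKernelDeg20P151
import Summits.Ventures.DiscreteObjects.Mahler.CensusKernelDeg20P152
import Summits.Ventures.DiscreteObjects.Mahler.CensusKernelDeg20P153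

/-!
# Kernel census, degree 20 (part C2): collector 2: imports chunk parts P101…P153

Cell `pub-namedobj`, seat `pub-namedobj-mahler-g16`. Framing: lottery ticket; floor = certified bounds/negative ranges.

Part of the kernel proof of `DegreeCensus 20 (13/10) coresDeg20` (see part A for the method: census search with
Toeplitz/resultant cuts, kernel-certified explicit-auxiliary-function cuts and certified leaf thresholds; 823081 leaves
with `c_1 >= 0`, 143927 survivors certified by extended certificates `CertX`: base red/cyc/exc or trace-Graeffe `tgr`).
This part holds, for the search nodes listed below, one kernel check each (`decide` with kernel reduction, standard axioms;
nodes costing more than the per-theorem budget are split by the next coefficient and re-assembled by a node lemma).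
CONTROL/replication of the published degree-20 list (Boyd 1980/1989; Mossinghoff 1998; Mossinghoff-Rhin-Wu 2008), not new ground.
-/

namespace Summit.Ventures.DiscreteObjects.Mahler

open Polynomial

/-- Collector 2 of the degree-20 kernel census imports chunk parts `P101` … `P153`; as its own (small) fact it records
that the search cut table `CT20` has one row per depth 1..10. -/
theorem CT20_length : CT20.length = 10 := by decide

end Summit.Ventures.DiscreteObjects.Mahler
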